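import Summits.ResolutionOfSingularities.ResolutionOfSingularities.Theorems.ThinnessCutKernels
import HarnessLib

/-!
# ThinnessCutCharTwo — §9 of lens-1 g12 «ThinnessCut» rev 3 (sha256 98f17d8edf72d004; critic row 86), VERBATIM

The `p = 2` PERFECT-GROUND-FIELD slice (`k = k̄`, `𝔽_q`, …): the pieces T′ = `TameStartLU` and T =
`StallStartLU` are VACUOUS there (kernel):
`exists_sub_sq_lt_one`, `not_tameHyp_two`, `not_stalled_two`, `tameStartLU_inst_two`, `stallStartLU_inst_two`.
[WRITER NOTE (decomp-res writer
g5): verbatim; the route-level `closes` dropped.]  (Sources: Cossart2011; CossartPiltant2019.)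
-/

namespace Summit.ResolutionOfSingularities.ResolutionOfSingularities.Theorems.ThinnessCutClasses

open IsLocalRing
open Literature.AlgebraicGeometry.Resolution
open Summit.ResolutionOfSingularities.ResolutionOfSingularities.Theses
open Summit.ResolutionOfSingularities.ResolutionOfSingularities.Theorems
open Summit.ResolutionOfSingularities.ResolutionOfSingularities.Theorems.SteerRankThinness
  (IsExcParam IsStrictStep IsTorsorRunUpTo IsTorsorRun InfiniteThinness not_isTorsorRun_of_infiniteThinness)
open scoped IntermediateField

variable {K : Type} [Field K]

/-! ## 9. The `p = 2` PERFECT-GROUND-FIELD slice (`k = k̄`, `𝔽_q`, …): pieces T′ and T are VACUOUS (kernel)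

Over a PERFECT ground field the residue `ā` of `a = t² ∈ A₀` along a zero-dimensional place is algebraic over
`k`, so `k⟮ā⟯` is perfect and `ā` is the square of a polynomial in `ā`: some shift `t² − g²`, `g ∈ A₀`, is a
non-unit (`exists_sub_sq_lt_one`); at `p = 2` the order-tame alternative `𝔪² ∖ 𝔪ᵖ = 𝔪² ∖ 𝔪²` is
empty.  Hence
the order-tame hypothesis is contradictory (`not_tameHyp_two`), no datum is stalled at its base
(`not_stalled_two`), and the `p = 2`, perfect-`k` instances of T′ and T hold vacuously (`tameStartLU_inst_two`,
`stallStartLU_inst_two`): on that slice the thinness cut leaves `ZenoLU` as the ONLY piece (modulo the tree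
anchor, whose reductions are bundled over all `p`). -/

/-- Zero-dimensionality over a PERFECT field of characteristic `2`: every `a ∈ A₀` is congruent to the SQUARE of an
element of `A₀` modulo the valuation ideal (the residue `ā` is algebraic over `k`, `k⟮ā⟯` is perfect, a square
root of `ā` there is a polynomial in `ā`, lift it). [folklore] -/
theorem exists_sub_sq_lt_one (k K : Type) [Field k] [PerfectField k] [CharP k 2] [Field K]
    [Algebra k K] (O : ValuationSubring K) (A₀ : Subalgebra k K) (h₀ : A₀.toSubring ≤ O.toSubring) (a : K)
    (ha : a ∈ A₀) (hzd : ∀ x : K, x ∈ O → ∃ f : Polynomial k, f ≠ 0 ∧ Polynomial.aeval x f ∈ O.nonunits) :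
    ∃ g ∈ A₀, O.valuation (a - g ^ 2) < 1 := by
  classical
  obtain ⟨f, hf0, hfa⟩ := hzd a (h₀ ha)
  have hlt : O.valuation (Polynomial.aeval a f) < 1 := (O.mem_nonunits_iff).mp hfa
  have hkO : ∀ c : k, algebraMap k K c ∈ O := fun c => h₀ (A₀.algebraMap_mem c)
  -- the residue field of `O` as a `k`-algebra
  set φ : k →+* O := (algebraMap k K).codRestrict O hkO with hφ
  letI : Algebra k (ResidueField O) := ((residue O).comp φ).toAlgebra
  have halg : ∀ c : k, algebraMap k (ResidueField O) c = residue O (φ c) := fun c => rfl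
  -- evaluation compatibilities
  have hevalO : ∀ (q : Polynomial k) (x : O), ((q.eval₂ φ x : O) : K) = Polynomial.aeval (x : K) q := by
    intro q x
    rw [Polynomial.aeval_def, show algebraMap k K = O.subtype.comp φ from rfl]
    exact Polynomial.hom_eval₂ q φ O.subtype x
  have hevalR : ∀ (q : Polynomial k) (x : O), residue O (q.eval₂ φ x) = Polynomial.aeval (residue O x) q := by
    intro q x
    rw [Polynomial.hom_eval₂, Polynomial.aeval_def]
    rfl
  -- membership in the maximal ideal ↔ valuation < 1
  have hmax : ∀ x : O, x ∈ maximalIdeal O ↔ O.valuation (x : K) < 1 := fun x =>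
    ValuationSubring.valuation_lt_one_iff O x
  set aO : O := ⟨a, h₀ ha⟩ with haO
  set abar : ResidueField O := residue O aO with habar
  -- `abar` is algebraic over `k`
  have hroot : Polynomial.aeval abar f = 0 := by
    rw [habar, ← hevalR, residue_eq_zero_iff, hmax, hevalO]
    exact hlt
  have hint : IsIntegral k abar := (isAlgebraic_iff_isIntegral).mp ⟨f, hf0, hroot⟩
  -- the field `k⟮abar⟯` is perfect of characteristic 2, so `abar` is a square there
  haveI : Algebra.IsAlgebraic k k⟮abar⟯ := IntermediateField.isAlgebraic_adjoin_simple hint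
  haveI : PerfectField k⟮abar⟯ := Algebra.IsAlgebraic.perfectField k
  haveI : CharP (ResidueField O) 2 := charP_of_injective_algebraMap (algebraMap k (ResidueField O)).injective 2
  haveI : CharP k⟮abar⟯ 2 := charP_of_injective_algebraMap (algebraMap k k⟮abar⟯).injective 2
  obtain ⟨b, hb⟩ := surjective_frobenius k⟮abar⟯ 2 ⟨abar, IntermediateField.mem_adjoin_simple_self k abar⟩
  have hb2 : (b : ResidueField O) ^ 2 = abar := by
    have := congrArg (fun z : k⟮abar⟯ => (z : ResidueField O)) hb
    simpa [frobenius_def] using this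
  -- `b` is a polynomial in `abar`
  have hbmem : (b : ResidueField O) ∈ Algebra.adjoin k {abar} := by
    rw [← IntermediateField.adjoin_simple_toSubalgebra_of_isAlgebraic hint.isAlgebraic]
    exact b.2
  rw [Algebra.adjoin_singleton_eq_range_aeval] at hbmem
  obtain ⟨q, hq⟩ := hbmem
  -- lift: g := q(a)
  refine ⟨Polynomial.aeval a q, ?_, ?_⟩
  · rw [← Polynomial.aeval_subalgebra_coe q A₀ ⟨a, ha⟩]
    exact (Polynomial.aeval (⟨a, ha⟩ : A₀) q).2
  · have hgO : ((q.eval₂ φ aO : O) : K) = Polynomial.aeval a q := hevalO q aO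
    have hmem : aO - (q.eval₂ φ aO) ^ 2 ∈ maximalIdeal O := by
      rw [← residue_eq_zero_iff, map_sub, map_pow, hevalR, ← habar]
      rw [show Polynomial.aeval abar q = (b : ResidueField O) from hq.symm ▸ rfl, hb2, sub_self]
    have := (hmax _).mp hmem
    simpa [hgO] using this

/-- **At `p = 2` over a PERFECT ground field the ORDER-TAME hypothesis is contradictory.** [folklore] -/
theorem not_tameHyp_two (k K : Type) [Field k] [PerfectField k] [CharP k 2] [Field K] [Algebra k K]
    (O : ValuationSubring K) (A₀ : Subalgebra k K) (h₀ : A₀.toSubring ≤ O.toSubring) (t : K)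
    (htp : t ^ 2 ∈ A₀)
    (hzd : ∀ x : K, x ∈ O → ∃ f : Polynomial k, f ≠ 0 ∧ Polynomial.aeval x f ∈ O.nonunits) :
    ¬ TameHyp 2 O A₀ h₀ t htp := by
  intro h
  obtain ⟨g, hgA, hd⟩ := exists_sub_sq_lt_one k K O A₀ h₀ (t ^ 2) htp hzd
  have hg : g ∈ locAtCentre A₀.toSubring O := le_locAtCentre _ O hgA
  rcases h g hg with hu | ⟨h2, h2'⟩
  · haveI := isLocalRing_locAtCentre (B := A₀.toSubring) (O := O) h₀
    have hdom := subringDominates_locAtCentre (B := A₀.toSubring) (O := O) h₀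
    have hval := (subringDominates_valuationSubring_iff hdom.1).mp hdom
    exact (IsLocalRing.mem_maximalIdeal _).mp ((hval _).mpr hd) hu
  · exact h2' h2

/-- Hence NO datum is stalled at its base at `p = 2` over a perfect ground field. [folklore] -/
theorem not_stalled_two (k K : Type) [Field k] [PerfectField k] [CharP k 2] [Field K] [Algebra k K]
    (O : ValuationSubring K) (A₀ : Subalgebra k K) (h₀ : A₀.toSubring ≤ O.toSubring) (t : K)
    (htp : t ^ 2 ∈ A₀)
    (hreg : IsRegularLocalRing (Localization.AtPrime (Ideal.comap (Subring.inclusion h₀) (maximalIdeal O))))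
    (hzd : ∀ x : K, x ∈ O → ∃ f : Polynomial k, f ≠ 0 ∧ Polynomial.aeval x f ∈ O.nonunits)
    (R : ℕ → Subring K) (hR : IsBaseSequence O A₀ R) :
    CanStep O R 2 (fun _ => t) 0 ∨ OrderOneAt (R 0) 2 t := by
  by_contra h
  push Not at h
  exact not_tameHyp_two k K O A₀ h₀ t htp hzd
    (tameHyp_of_stalled 2 Nat.prime_two O A₀ h₀ t htp hreg R hR h.1 h.2)

/-- **The `p = 2`, perfect-`k` instance of piece T′ holds VACUOUSLY** (this is literally `hT 2 Nat.prime_two …`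
for `hT : TameStartLU`, see the probe file's control). [folklore] -/
theorem tameStartLU_inst_two (k K : Type) [Field k] [PerfectField k] [CharP k 2] [Field K] [Algebra k K]
    (O : ValuationSubring K) (A₀ : Subalgebra k K) (h₀ : A₀.toSubring ≤ O.toSubring) (t : K)
    (_hfg : A₀.FG) (htp : t ^ 2 ∈ A₀) (_hfr : IsFractionRing (Algebra.adjoin k (insert t (A₀ : Set K))) K)
    (_hreg : IsRegularLocalRing (Localization.AtPrime (Ideal.comap (Subring.inclusion h₀) (maximalIdeal O))))
    (hcs : CoreSide k K O) (hhyp : TameHyp 2 O A₀ h₀ t htp) : Concl O A₀ t :=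
  absurd hhyp (not_tameHyp_two k K O A₀ h₀ t htp hcs.1)

/-- **The `p = 2`, perfect-`k` instance of piece T holds VACUOUSLY.** [folklore] -/
theorem stallStartLU_inst_two (k K : Type) [Field k] [PerfectField k] [CharP k 2] [Field K] [Algebra k K]
    (O : ValuationSubring K) (A₀ : Subalgebra k K) (h₀ : A₀.toSubring ≤ O.toSubring) (t : K)
    (_hfg : A₀.FG) (htp : t ^ 2 ∈ A₀) (_hfr : IsFractionRing (Algebra.adjoin k (insert t (A₀ : Set K))) K)
    (hreg : IsRegularLocalRing (Localization.AtPrime (Ideal.comap (Subring.inclusion h₀) (maximalIdeal O))))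
    (hcs : CoreSide k K O)
    (hst : ∃ R : ℕ → Subring K, IsBaseSequence O A₀ R ∧ ¬ CanStep O R 2 (fun _ => t) 0 ∧ ¬ OrderOneAt (R 0) 2 t) :
    Concl O A₀ t := by
  obtain ⟨R, hR, hcan, hone⟩ := hst
  rcases not_stalled_two k K O A₀ h₀ t htp hreg hcs.1 R hR with h | h
  · exact absurd h hcan
  · exact absurd h hone

end Summit.ResolutionOfSingularities.ResolutionOfSingularities.Theorems.ThinnessCutClasses
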